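import Literature.MathematicalPhysics.QuantumFieldTheory.Balaban1983to89.B6Prop26KLevelSkeletonV1
import Literature.MathematicalPhysics.QuantumFieldTheory.Balaban1983to89.B6Ineq2134KFamKLevel

/-!
# `Balaban1983to89.B6Prop26KLevelSkeletonV2` — T. Bałaban, *Propagators and renormalization transformations for lattice gauge theories. II*,
# Commun. Math. Phys. **96** (1984) 223–250 [Balaban1984PropagatorsII], Prop. 2.6 (2.136)₁ p. 247 for the GENUINE `k`-level `G = Δ_a⁻¹` on the
# V1 torus — THE k-LEVEL SKELETON WITH TWO SET FAMILIES (`S_□ = □⁺ ⊋ supp h_□` for (2.133), `U_□ = □̃ ⊇ supp ζ_□` for the output localisation of the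
# (2.91) kernels): the repair of finding F5 of the fold owner (ROUTE V, B6-CLOSURE §5 item 14)

statement-level skeleton of published theorems with citation tags; proofs where landed; nothing here is a claim about the Yang–Mills mass gap

PDF held: `paper:balaban1984-cmp96-propagators-rt-ii` (journal page = PDF page + 222): p. 239 [PDF 17] ((2.91)–(2.93): *"ζ_□ ∈ C₀^∞(□̃), ζ_□ = 1 on a
neighbourhood of supp h_□"*), p. 247 [PDF 25] ((2.133)–(2.136)), p. 235 [PDF 13] (*"a second cube □̃ containing □ in the middle"*); read from the tree
transcriptions in `…B6Prop26KLevelSkeletonV1`, `…B6Prop26ChainGeneric`, `…B6Prop26Gluing`.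

CITATION HEADER (lean-in-tree rule) — WHAT IS REPRODUCED.  Phase-2 file of the `lit-balaban` typed skeleton (HOME `run/shared/lean/pub/lit-balaban/`), unit
`lit-balaban-r03` (B6 fold owner; r03 gen 21, literature-prover-lit-balaban-r03-g21-0), referee ref-4.  SKELETON rows **B6.Prop2.6** × **B6.Eq2.91** ×
**B6.Eq2.134** × B6.Eq2.133 × B6.Eq2.36 (cells; decls of record untouched).  FINDING F5 (owner, 2026-08-23T07:38Z): the gen-19 skeleton
`…B6Prop26KLevelSkeletonV1.prop26_2136_kLevel_skeleton` uses ONE family of sets `Q^T_□ = □⁺` (p38's `QT`, radius `5S/4`) for the support of `h_□`, the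
(2.133) local majorant, the overlap number AND the output localisation `hKout` of `K_{□,□′}G_{□′}`; but the diagonal kernel (2.92)
`K_{□,□} = (h_□M_□ − M_□h_□) + ζ_□(∂P∂* − P_□)h_□ + ζ_□(P_□h_□ − h_□P_□)` has outputs on `supp ζ_□ = □̃` (p38's `QbigT`, radius `7S/4`) `⊋ □⁺`, so that `hKout`
cannot be discharged for the genuine family (the V1 theorems are true, with an unsatisfiable hypothesis).  THIS FILE states and proves the skeleton with
TWO families, importing by name and restating nothing: `B6Prop26Gluing.majorant_G0_of_2133`/`ineq2135_of_2134_291` (pv09), `B6Prop26ChainGeneric.prop26_chain_2136With`,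
`B6Prop26.fixedPoint_of_291`, `B6Ineq2134KFamKLevel.outLoc_kFam` (p38), and everything `…B6Prop26KLevelSkeletonV1` imports (`eq291`, `lemma21_torus`,
`deltaAE_split`, `GE_comp_deltaAE`, p38's `hT`/`zetaT`/`QT`/`QbigT`).

## WHAT THIS FILE CERTIFIES (kernel-checked, 0 sorry, standard axioms; no `def … : Prop`, no new named fact; ONE definition WITH BODY: `SbigT` (the set `□̃` of sites, companion of V1's `ST`))

* §1 **`prop26_2136_of_2133_2134With₂`** — the generic gluing (pv09's `prop26_2136_of_2133_2134With`) with TWO set families: `S_□` carries `supp h_□` and the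
  (2.133) local majorant of `G_□` (the `G₀ = Σ h_□G_□h_□` term), `U_□ ⊇ S_□` carries the output localisation of `K_{□,□′}G_{□′}` (the `R`-term (2.135)); one
  overlap number `N` of the `U_□` serves both (`card_filter_mono`).
* §2 the torus data: `SbigT`/`mem_SbigT` (`□̃` as a set of sites), `ST_subset_SbigT`, `hNov_SbigT_of_QbigT` (a count of the finite sets `QbigT □` — p21's
  shape — bounds the overlap of the `SbigT □`), `blkV1_mem_SbigT_of_zB_ne_zero` (`supp ζ_□ ⊂ □̃` blockwise — `zetaT` is the indicator of `QbigT`),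
  `blkV1_mem_SbigT_of_hB_ne_zero` (`supp h_□ ⊂ □⁺ ⊂ □̃`), **`outLoc_kFam_big`** (hKout over `□̃` from ONE
  honest input: the output localisation `OutLoc (M_□·h_□) □̃` of the member's local operator — p38's `outLoc_kFam`), `kFam_smul` (the (2.91) family is
  homogeneous of degree one in `(∂P∂*, M_□, P_□)`: `kFam (s•Dg) h ζ (s•M) (s•P) = s•kFam Dg h ζ M P` — the unit bookkeeping of the assembly).
* §3 **`prop26_2136_kLevel_skeleton₂`** — PROPOSITION 2.6 (2.136)₁ FOR THE GENUINE k-LEVEL `G = GE (domT hN D hk)`: the statement of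
  `prop26_2136_kLevel_skeleton` with (h2133) on `Q^T_□ = □⁺` UNCHANGED, the overlap number `Nov` now of the `□̃ = QbigT`, and (hKout) over `□̃`; and
  **`prop26_2136_kLevel_skeleton₂'`** — the same with (hKout) DISCHARGED from `hMout : OutLoc (M_□·h_□) □̃` per cube.

## HONEST SCOPE / DIVERGENCES

(1) As `…B6Prop26KLevelSkeletonV1` (member operators displayed; `L ≥ 2`, `M_h ≥ 2`, `R ≥ 2L`, `P′_μ ≥ 5`; `k ≤ m + K`; lattice factor `c′` free; entries
(2.136)₂₋₄ untouched).  (2) The two radii `5S/4` (□⁺ ⊃ supp h_□) and `7S/4` (□̃ = supp ζ_□) are p38's (`B6Cover236MultiLevelBlocks.Q`,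
`B6Partition118KLevelFineLip.Qbig`); print's □̃ «of the size 4M».  (3) The overlap number of the `□̃` is a displayed parameter here (p21's count
`card_filter_mem_QT_le` is for `□⁺`; the `□̃` count is requested, finding F5 (i)).  (4) The V1 skeleton and its corollaries in `…B6CubeWindowV1`
(`prop26_2136_kLevel_cubes`, `_band`, `_band_nov`) stay in the tree as true statements whose `hKout` is not dischargeable for the genuine family; their
(h2133)/(hagree)/(hinvl) discharges are reused verbatim by the successors built on THIS file.  Value = typed skeleton repair; NOT summit progress.
-/

open scoped BigOperators
open Finset

namespace Literature.MathematicalPhysics.QuantumFieldTheory.Balaban1983to89.B6Prop26KLevelSkeletonV2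

open B4Reflection242 (boxDom)
open B6MultiLevelBoxOperator (N0)
open B6MultiLevelTorusOperator (TDomains)
open B6Cover236MultiLevelBlocks (cubes)
open B6Geom246MultiLevelBox (bset blkOf)
open B6Geom246MultiLevelTorus (geomT lemma21_torus triangle_refl_nonneg_T)
open B6RandomWalk (HasMajorant hasMajorant_mono delta3 Triangle254)
open B6Prop26Gluing (mulOp mulOp_apply LocalMajorant OutLoc majorant_G0_of_2133 ineq2135_of_2134_291)
open B6Prop26 (fixedPoint_of_291)
open B6Lemma21Repaired (Ineq261With Ineq263With)
open B6Ineq261LevelGap (K261 K261_nonneg)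
open B6Prop26ChainGeneric (prop26_chain_2136With)
open B6Eq291Generator (kFam kDiag kOff gZero rOp eq291)
open B6Ineq2133TwoScaleV1 (onFun)
open B6GlobalChartV1 (PV toBox domT blkV1)
open B6AgreeLapV1Chart (deltaAE_split onFun_comp onFun_id)
open B6SectAOperatorsV1 (dE dsE dcE dcsE QE aE QsE RE BondIdx)
open B6SectAVectorModelV1 (deltaAE GE GE_comp_deltaAE)
open B6Partition118KLevelTorus (hT sum_hT_sq abs_hT_le_one)
open B6Partition118KLevelTorusCentral (QT QbigT zetaT QT_subset_QbigT one_le_of_four_le)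
open B6Prop26KLevelSkeletonV1 (hB zB ST mem_ST pref pref_nonneg sum_hB_sq abs_hB_le_one blkV1_mem_QT_of_hB_ne_zero mulOp_zB_mul_hB mulOp_hB_mul_zB
  sum_mulOp_hB_sq onFun_GE_mul_deltaAE)
open B6Ineq2134KFamKLevel (outLoc_kFam)

noncomputable section

/-! ## §1  The gluing with two set families -/

section Gluing

variable {g : B6.Geometry} {X : Type}

/-- an overlap bound for the bigger sets bounds the overlap of the smaller ones. [cite: Balaban1984PropagatorsII, p.235, bookkeeping] -/
theorem card_filter_mono {C : Type} (D : Finset C) {S U : C → Set g.Site} (hSU : ∀ i ∈ D, S i ⊆ U i) {N : ℕ}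
    [∀ (a : g.Site) i, Decidable (a ∈ S i)] [∀ (a : g.Site) i, Decidable (a ∈ U i)]
    (hN : ∀ a : g.Site, (D.filter fun i => a ∈ U i).card ≤ N) (a : g.Site) : (D.filter fun i => a ∈ S i).card ≤ N :=
  (Finset.card_le_card (fun i hi => by
    rw [Finset.mem_filter] at hi ⊢
    exact ⟨hi.1, hSU i hi.1 hi.2⟩)).trans (hN a)

open Classical in
/-- **PROP. 2.6, ENTRY |(GJ)(x)| OF (2.136), FROM THE PER-BOX INPUTS, WITH TWO SET FAMILIES** (pv09's `prop26_2136_of_2133_2134With` repaired for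
the genuine (2.91) family): boxes `𝒟` with sets `S_□ ⊆ U_□` of sites, `U_□` of overlap number `N`; partition functions `h_□` (`|h_□| ≤ 1`, supported within
the blocks of `S_□`); box operators `G_□` with the local bound (2.133) `A·P(y)·e^{−½δ₂d}` on `S_□`; pair operators `K_{□,□′}G_{□′}` OUTPUT-LOCALISED TO `U_□`
with (2.134) `θ₀e^{−½δ₂d}`; `G₀ = Σ h_□G_□h_□`, `R = Σ K_{□,□′}G_{□′}h_{□′}`, (2.91) `Δ_aG₀ = I − R`, `GΔ_a = I`; then under `N²θ₀c < 1`, `G` has the majorant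
`(N·A)·c·(1 − N²θ₀c)⁻¹·P(y)·e^{−δ₃d}`, `δ₃ = delta3 α δ₂`.  (Print: `supp h_□ ⊂` the reach `□⁺ = S_□`, `supp ζ_□ = □̃ = U_□`.)
[cite: Balaban1984PropagatorsII, Prop. 2.6 (2.136) p.247; (2.91)–(2.93) p.239; (2.133)–(2.135) p.247] -/
theorem prop26_2136_of_2133_2134With₂ [Fintype X] [DecidableEq X] (blk : X → g.Site) (c δ₂ α θ₀ A : ℝ)
    (P : g.Site → ℝ) (hc : 0 ≤ c) (hA : 0 ≤ A) (hP : ∀ y, 0 ≤ P y) (hθ₀ : 0 ≤ θ₀) (hα : α ≤ 1) (hδ₂ : 0 ≤ δ₂)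
    (htri : Triangle254 g) (hrefl : ∀ y : g.Site, g.dist y y = 0) (hdnn : ∀ y y' : g.Site, 0 ≤ g.dist y y')
    (h261 : Ineq261With c g (δ₂ / 2) α) (h263 : Ineq263With c g (δ₂ / 2) α)
    {C : Type} (D : Finset C) (S U : C → Set g.Site) (hSU : ∀ i ∈ D, S i ⊆ U i) (N : ℕ)
    (hN : ∀ a : g.Site, (D.filter fun i => a ∈ U i).card ≤ N)
    (hsmall : (N : ℝ) ^ 2 * θ₀ * c < 1)
    (h : C → X → ℝ) (hsupp : ∀ i ∈ D, ∀ x, h i x ≠ 0 → blk x ∈ S i) (hle : ∀ i ∈ D, ∀ x, |h i x| ≤ 1)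
    (Gl : C → Module.End ℝ (X → ℝ))
    (h2133 : ∀ i ∈ D,
      LocalMajorant blk (Gl i) (S i) (fun a b => A * P a * Real.exp (-(δ₂ / 2 * g.dist a b))))
    (Kt : C → C → Module.End ℝ (X → ℝ))
    (h2134 : ∀ i ∈ D, ∀ i' ∈ D,
      HasMajorant blk (Kt i i' * mulOp (h i')) (fun a b => θ₀ * Real.exp (-(δ₂ / 2 * g.dist a b))))
    (hKout : ∀ i ∈ D, ∀ i' ∈ D, OutLoc blk (Kt i i') (U i))
    {G G0 R Δa : Module.End ℝ (X → ℝ)}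
    (hG0 : G0 = ∑ i ∈ D, mulOp (h i) * Gl i * mulOp (h i))
    (hR : R = ∑ i ∈ D, ∑ i' ∈ D, Kt i i' * mulOp (h i'))
    (hinv : G * Δa = 1) (h291 : Δa * G0 = 1 - R) :
    HasMajorant blk G (fun a b => (N * A) * c * (1 - (N : ℝ) ^ 2 * θ₀ * c)⁻¹ * P a *
      Real.exp (-(delta3 α δ₂ * g.dist a b))) := by
  have hK : ∀ a b, 0 ≤ A * P a * Real.exp (-(δ₂ / 2 * g.dist a b)) := fun a b =>
    mul_nonneg (mul_nonneg hA (hP a)) (Real.exp_nonneg _)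
  have hNS : ∀ a : g.Site, (D.filter fun i => a ∈ S i).card ≤ N := card_filter_mono D hSU hN
  have hG0m : HasMajorant blk G0 (fun a b => N * A * P a * Real.exp (-(δ₂ / 2 * g.dist a b))) := by
    rw [hG0]
    refine hasMajorant_mono blk (majorant_G0_of_2133 blk D S N hNS h hsupp hle Gl _ hK h2133) fun a b => le_of_eq ?_
    ring
  have hsuppU : ∀ i ∈ D, ∀ x, h i x ≠ 0 → blk x ∈ U i := fun i hi x hx => hSU i hi (hsupp i hi x hx)
  have hRm : HasMajorant blk R (fun a b => (N : ℝ) ^ 2 * θ₀ * Real.exp (-(δ₂ / 2 * g.dist a b))) :=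
    ineq2135_of_2134_291 blk D U N hN h hsuppU Kt δ₂ θ₀ hθ₀ h2134 hKout hR
  have hfix : G = G0 + G * R := fixedPoint_of_291 hinv h291
  exact prop26_chain_2136With blk c δ₂ α ((N : ℝ) ^ 2 * θ₀) (N * A) P hc (mul_nonneg (Nat.cast_nonneg N) hA) hP
    (mul_nonneg (sq_nonneg _) hθ₀) hα hδ₂ htri hrefl hdnn h261 h263 hsmall hG0m hRm hfix

/-- **THE (2.91) FAMILY IS HOMOGENEOUS OF DEGREE ONE IN `(∂P∂*, M_□, P_□)`**: `K_{□,□′}` built from `s•∂P∂*`, `s•M_□`, `s•P_□` (same `h_□`, `ζ_□`) is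
`s•K_{□,□′}` — the unit bookkeeping that lets a consumer feed (2.134) proved in one normalisation of the member operators into the skeleton stated in
another (`(s•K)(s⁻¹… )`). [cite: Balaban1984PropagatorsII, (2.91)–(2.93) p.239] -/
theorem kFam_smul {𝔄 : Type} [Ring 𝔄] [Algebra ℝ 𝔄] {ι : Type} [DecidableEq ι] (s : ℝ) (Dg : 𝔄) (h z M Pm : ι → 𝔄) (i j : ι) :
    kFam (s • Dg) h z (fun i => s • M i) (fun i => s • Pm i) i j = s • kFam Dg h z M Pm i j := by
  unfold kFam kDiag kOff
  split_ifs
  · simp only [smul_sub, smul_add, mul_smul_comm, smul_mul_assoc, mul_sub, sub_mul, mul_assoc]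
  · simp only [mul_smul_comm, smul_mul_assoc, mul_assoc]

end Gluing

/-! ## §2  The torus data for the two families `□⁺ = QT`, `□̃ = QbigT` -/

section Data

variable {d ℓ : ℕ} {hd : 1 ≤ d + 1} {hL : Odd (ℓ + 1) ∧ 1 < ℓ + 1} {m K : ℕ} {Mh k R : ℕ} {P' : Fin (d + 1) → ℕ}
variable (hN : ∀ μ, N0 ℓ Mh k P' μ = (PV d ℓ m K hd hL).sitesPerDir 0) (D : TDomains d ℓ Mh k P' R)

/-- **THE CUT-OFF SET `□̃` AS A SET OF SITES OF `geomT D`** (p38's `QbigT`: the blocks within `7S_j/4` of the cube's centre, through the block map) — the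
carrier of `supp ζ_□` and of the outputs of the (2.91) kernels; companion of `…B6Prop26KLevelSkeletonV1.ST` (`□⁺`).  (A definition, so that — as for
`ST` — membership is decided classically wherever an overlap number is counted.) [cite: Balaban1984PropagatorsII, p.239 («ζ_□ ∈ C₀^∞(□̃)»), p.235, dictionary] -/
def SbigT (hMh1 : 1 ≤ Mh) (hP4 : ∀ μ, 4 ≤ P' μ) (c : ↥(cubes D.toDomains)) : Set (geomT D).Site := {a | a ∈ QbigT D hMh1 hP4 c}

/-- membership in `SbigT`. [cite: Balaban1984PropagatorsII, p.239, dictionary] -/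
@[simp] theorem mem_SbigT (hMh1 : 1 ≤ Mh) (hP4 : ∀ μ, 4 ≤ P' μ) (c : ↥(cubes D.toDomains)) (a : (geomT D).Site) :
    a ∈ SbigT D hMh1 hP4 c ↔ a ∈ QbigT D hMh1 hP4 c := Iff.rfl

/-- `□⁺ ⊆ □̃` as sets of sites. [cite: Balaban1984PropagatorsII, p.235, p.239, bookkeeping] -/
theorem ST_subset_SbigT (hMh1 : 1 ≤ Mh) (hP4 : ∀ μ, 4 ≤ P' μ) (c : ↥(cubes D.toDomains)) :
    ST D hMh1 hP4 c ⊆ SbigT D hMh1 hP4 c := fun a ha => QT_subset_QbigT hMh1 hP4 c ((mem_ST D hMh1 hP4 c a).1 ha)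

open Classical in
/-- an overlap bound of the finite sets `QbigT □` is an overlap bound of the sets `SbigT □` (the shape of `prop26_2136_kLevel_skeleton₂`'s `hNov`).
[cite: Balaban1984PropagatorsII, p.235, bookkeeping] -/
theorem hNov_SbigT_of_QbigT (hMh1 : 1 ≤ Mh) (hP4 : ∀ μ, 4 ≤ P' μ) {Nov : ℕ}
    (hNov : ∀ a : (geomT D).Site, (Finset.univ.filter fun c : ↥(cubes D.toDomains) => a ∈ QbigT D hMh1 hP4 c).card ≤ Nov) :
    ∀ a : (geomT D).Site, (Finset.univ.filter fun c : ↥(cubes D.toDomains) => a ∈ SbigT D hMh1 hP4 c).card ≤ Nov := by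
  intro a
  have e : (Finset.univ.filter fun c : ↥(cubes D.toDomains) => a ∈ SbigT D hMh1 hP4 c) =
      (Finset.univ.filter fun c : ↥(cubes D.toDomains) => a ∈ QbigT D hMh1 hP4 c) := by
    ext c
    simp only [Finset.mem_filter, mem_SbigT]
  rw [e]
  exact hNov a

/-- **`supp ζ_□ ⊂ □̃`** blockwise: `ζ_□(b) ≠ 0 ⟹ y(b₋) ∈ QbigT □` (`zetaT` is the indicator of the blocks of `□̃`).
[cite: Balaban1984PropagatorsII, (2.91) p.239 («ζ_□ ∈ C₀^∞(□̃)»)] -/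
theorem blkV1_mem_SbigT_of_zB_ne_zero (hMh1 : 1 ≤ Mh) (hP4 : ∀ μ, 4 ≤ P' μ) (c : ↥(cubes D.toDomains)) {b : PBond (PV d ℓ m K hd hL) 0}
    (h : zB hN D hMh1 hP4 c b ≠ 0) : blkV1 hN D b ∈ SbigT D hMh1 hP4 c := by
  have key : blkOf D.toDomains (toBox hN b.src) ∈ QbigT D hMh1 hP4 c := by
    by_contra hq
    exact h (by unfold zB zetaT; rw [if_neg hq])
  exact key

/-- **`supp h_□ ⊂ □̃`** blockwise (`□⁺ ⊆ □̃`). [cite: Balaban1984PropagatorsII, (2.36) p.229, p.239] -/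
theorem blkV1_mem_SbigT_of_hB_ne_zero (hMh : 2 ≤ Mh) (hR : 2 * (ℓ + 1) ≤ R) {hMh1 : 1 ≤ Mh} (hP4 : ∀ μ, 4 ≤ P' μ) (c : ↥(cubes D.toDomains))
    {b : PBond (PV d ℓ m K hd hL) 0} (h : hB hN D c b ≠ 0) : blkV1 hN D b ∈ SbigT D hMh1 hP4 c :=
  ST_subset_SbigT D hMh1 hP4 c (blkV1_mem_QT_of_hB_ne_zero hN D hMh hR hP4 c h)

/-- **hKout OVER `□̃` FROM ONE INPUT**: if the member's local operator applied after `h_□` has outputs in `□̃` (`OutLoc (M_□·h_□) □̃` — bond range one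
around `supp h_□ ⊂ □⁺`), then every `K_{□,□′}G_{□′}` of the genuine (2.91) family is output-localised to `□̃` (p38's `outLoc_kFam` with `supp h_□, supp ζ_□ ⊂ □̃`).
[cite: Balaban1984PropagatorsII, (2.91)–(2.93) p.239] -/
theorem outLoc_kFam_big (hMh : 2 ≤ Mh) (hR : 2 * (ℓ + 1) ≤ R) (hMh1 : 1 ≤ Mh) (hP4 : ∀ μ, 4 ≤ P' μ)
    (Dg : Module.End ℝ (PBond (PV d ℓ m K hd hL) 0 → ℝ)) (Gl Ml Pl : ↥(cubes D.toDomains) → Module.End ℝ (PBond (PV d ℓ m K hd hL) 0 → ℝ))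
    (hMout : ∀ c, OutLoc (g := geomT D) (blkV1 hN D) (Ml c * mulOp (hB hN D c)) (SbigT D hMh1 hP4 c)) :
    ∀ c c', OutLoc (g := geomT D) (blkV1 hN D)
      (kFam Dg (fun c => mulOp (hB hN D c)) (fun c => mulOp (zB hN D hMh1 hP4 c)) Ml Pl c c' * Gl c') (SbigT D hMh1 hP4 c) := by
  intro c c'
  exact outLoc_kFam (g := geomT D) (blkV1 hN D) Finset.univ (Dg := Dg) (G := Gl) (Ml := Ml) (Pl := Pl) (h := hB hN D) (ζ := zB hN D hMh1 hP4)
    (T := fun c => SbigT D hMh1 hP4 c)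
    (fun c _ x hx => blkV1_mem_SbigT_of_hB_ne_zero hN D hMh hR hP4 c hx)
    (fun c _ x hx => blkV1_mem_SbigT_of_zB_ne_zero hN D hMh1 hP4 c hx) (fun c _ => hMout c) c (Finset.mem_univ _) c' (Finset.mem_univ _)

end Data

/-! ## §3  Proposition 2.6 (2.136)₁ at k levels — the two-family skeleton -/

section Skeleton

variable {d ℓ : ℕ} {hd : 1 ≤ d + 1} {hL : Odd (ℓ + 1) ∧ 1 < ℓ + 1} {m K : ℕ} {Mh k R : ℕ} {P' : Fin (d + 1) → ℕ}

open Classical in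
/-- **PROPOSITION 2.6, ENTRY (2.136)₁, FOR THE GENUINE k-LEVEL `G = Δ_a⁻¹` ON THE V1 TORUS — THE TWO-FAMILY SKELETON** (repair of
`prop26_2136_kLevel_skeleton`, finding F5): hypotheses and conclusion as there, EXCEPT: the overlap number `Nov` is that of the sets `□̃ = QbigT □` and the
output localisation (hKout) of `K_{□,□′}G_{□′}` is over `□̃`; (h2133) stays the local majorant on `□⁺ = Q^T_□`, `supp h_□ ⊂ □⁺`.  Conclusion:
`HasMajorant (geomT D) (blkV1 hN D) G ((Nov·A)·c₁·(1 − Nov²θ₀c₁)⁻¹·(L^{j(y)}/c′)²·e^{−δ₃d_T})`, `c₁ = K261 N₀ (d+1) L 1 (αδ/(d+1))`, `δ₃ = delta3 α (2δ/(d+1))`.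
[cite: Balaban1984PropagatorsII, Prop. 2.6 (2.136) p.247, (2.133)–(2.135) p.247, (2.91)–(2.93) p.239, (2.36) p.229, Lemma 2.1 p.234] -/
theorem prop26_2136_kLevel_skeleton₂ (hN : ∀ μ, N0 ℓ Mh k P' μ = (PV d ℓ m K hd hL).sitesPerDir 0) (D : TDomains d ℓ Mh k P' R) (hk : k ≤ m + K)
    (hMh : 2 ≤ Mh) (hR : 2 * (ℓ + 1) ≤ R) (hP5 : ∀ μ, 5 ≤ P' μ)
    {δ A : ℝ} (hδ : 0 < δ) (hA : 0 ≤ A)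
    (α : ℝ) (hα0 : 0 ≤ α) (hα1 : α ≤ 1) (N₀ : ℕ) (hN₀ : 0 < N₀) (hRM : N₀ + 1 ≤ R * ((ℓ + 1) * Mh))
    (hθ : Real.exp (-(α * (δ / (d + 1)))) * ((ℓ : ℝ) + 1) ^ ((2 * (d + 1 : ℕ) : ℝ) / N₀) < 1)
    {cf : ℝ} (hcf : cf ≠ 0) {w : BondIdx (domT hN D hk) → ℝ} (hw : ∀ i, 0 < w i)
    -- overlap of the OUTPUT sets `□̃`
    (Nov : ℕ) (hNov : ∀ a : (geomT D).Site, (Finset.univ.filter fun c : ↥(cubes D.toDomains) =>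
      a ∈ SbigT D (le_trans one_le_two hMh) (fun μ => le_trans (by norm_num) (hP5 μ)) c).card ≤ Nov)
    (Gl Ml Pl : ↥(cubes D.toDomains) → Module.End ℝ (PBond (PV d ℓ m K hd hL) 0 → ℝ))
    (h2133 : ∀ c, LocalMajorant (g := geomT D) (blkV1 hN D) (Gl c)
      (ST D (le_trans one_le_two hMh) (fun μ => le_trans (by norm_num) (hP5 μ)) c)
      (fun a b => A * pref cf a * Real.exp (-((2 * (δ / (d + 1))) / 2 * (geomT D).dist a b))))
    (hagree : ∀ c, onFun (dcsE (P := PV d ℓ m K hd hL) cf ∘ₗ dcE cf + dE cf ∘ₗ dsE cf +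
        QsE (domT hN D hk) ∘ₗ aE (domT hN D hk) w ∘ₗ QE (domT hN D hk)) * mulOp (hB hN D c) = Ml c * mulOp (hB hN D c))
    (hinvl : ∀ c, (Ml c - Pl c) * Gl c * mulOp (hB hN D c) = mulOp (hB hN D c))
    (θ₀ : ℝ) (hθ₀ : 0 ≤ θ₀)
    (h2134 : ∀ c c', HasMajorant (g := geomT D) (blkV1 hN D)
      ((kFam (onFun (dE (P := PV d ℓ m K hd hL) cf ∘ₗ (LinearMap.id - RE (domT hN D hk) cf) ∘ₗ dsE cf))
          (fun c => mulOp (hB hN D c)) (fun c => mulOp (zB hN D (le_trans one_le_two hMh) (fun μ => le_trans (by norm_num) (hP5 μ)) c))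
          Ml Pl c c' * Gl c') * mulOp (hB hN D c'))
      (fun a b => θ₀ * Real.exp (-((2 * (δ / (d + 1))) / 2 * (geomT D).dist a b))))
    (hKout : ∀ c c', OutLoc (g := geomT D) (blkV1 hN D)
      (kFam (onFun (dE (P := PV d ℓ m K hd hL) cf ∘ₗ (LinearMap.id - RE (domT hN D hk) cf) ∘ₗ dsE cf))
          (fun c => mulOp (hB hN D c)) (fun c => mulOp (zB hN D (le_trans one_le_two hMh) (fun μ => le_trans (by norm_num) (hP5 μ)) c))
          Ml Pl c c' * Gl c')
      (SbigT D (le_trans one_le_two hMh) (fun μ => le_trans (by norm_num) (hP5 μ)) c))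
    (hsmall : (Nov : ℝ) ^ 2 * θ₀ * K261 N₀ (d + 1) ((ℓ : ℝ) + 1) 1 (α * (δ / (d + 1))) < 1) :
    HasMajorant (g := geomT D) (blkV1 hN D) (onFun (GE (domT hN D hk) hcf hw))
      (fun a b => (Nov * A) * K261 N₀ (d + 1) ((ℓ : ℝ) + 1) 1 (α * (δ / (d + 1))) *
        (1 - (Nov : ℝ) ^ 2 * θ₀ * K261 N₀ (d + 1) ((ℓ : ℝ) + 1) 1 (α * (δ / (d + 1))))⁻¹ * pref cf a *
        Real.exp (-(delta3 α (2 * (δ / (d + 1))) * (geomT D).dist a b))) := by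
  classical
  have hMh1 : 1 ≤ Mh := le_trans one_le_two hMh
  have hP4 : ∀ μ, 4 ≤ P' μ := fun μ => le_trans (by norm_num) (hP5 μ)
  have hP : ∀ μ, 1 ≤ P' μ := one_le_of_four_le hP4
  have hδ0 : (0 : ℝ) ≤ δ / (d + 1) := by positivity
  obtain ⟨_, h261, _, h263⟩ := lemma21_torus D hMh1 hP hN₀ hRM hδ0 hα0 hα1 hθ
  obtain ⟨htri, hrefl, hdnn⟩ := triangle_refl_nonneg_T D hMh1 hP
  have hc : 0 ≤ K261 N₀ (d + 1) ((ℓ : ℝ) + 1) 1 (α * (δ / (d + 1))) := K261_nonneg (by positivity) zero_le_one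
  have hδ2 : (0 : ℝ) ≤ 2 * (δ / (d + 1)) := by positivity
  have hhalf : 2 * (δ / (d + 1)) / 2 = δ / (d + 1) := by ring
  have hle : ∀ c ∈ (Finset.univ : Finset ↥(cubes D.toDomains)), ∀ b, |hB hN D c b| ≤ 1 := fun c _ b => abs_hB_le_one hN D hMh1 hP c b
  have hsupp : ∀ c ∈ (Finset.univ : Finset ↥(cubes D.toDomains)), ∀ b, hB hN D c b ≠ 0 →
      blkV1 hN D b ∈ ST D hMh1 hP4 c := fun c _ b hb => blkV1_mem_QT_of_hB_ne_zero hN D hMh hR hP4 c hb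
  have h291 : onFun (deltaAE (domT hN D hk) cf w) * gZero Finset.univ (fun c => mulOp (hB hN D c)) Gl =
      1 - rOp Finset.univ (onFun (dE (P := PV d ℓ m K hd hL) cf ∘ₗ (LinearMap.id - RE (domT hN D hk) cf) ∘ₗ dsE cf))
        (fun c => mulOp (hB hN D c)) (fun c => mulOp (zB hN D hMh1 hP4 c)) Gl Ml Pl := by
    rw [deltaAE_split]
    exact eq291 Finset.univ _ _ (fun c => mulOp (hB hN D c)) (fun c => mulOp (zB hN D hMh1 hP4 c)) Gl Ml Pl
      (sum_mulOp_hB_sq hN D hMh1 hP) (fun c _ => hagree c) (fun c _ => hinvl c)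
      (fun c _ => mulOp_zB_mul_hB hN D hMh hR hP4 c) (fun c _ => mulOp_hB_mul_zB hN D hMh hR hP4 c)
  have hinv := onFun_GE_mul_deltaAE (domT hN D hk) hcf hw
  have hmain := prop26_2136_of_2133_2134With₂ (g := geomT D) (blkV1 hN D) (K261 N₀ (d + 1) ((ℓ : ℝ) + 1) 1 (α * (δ / (d + 1))))
    (2 * (δ / (d + 1))) α θ₀ A (pref cf) hc hA (pref_nonneg cf) hθ₀ hα1 hδ2 htri hrefl hdnn (by rw [hhalf]; exact h261) (by rw [hhalf]; exact h263)
    Finset.univ (fun c => ST D hMh1 hP4 c) (fun c => SbigT D hMh1 hP4 c) (fun c _ => ST_subset_SbigT D hMh1 hP4 c)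
    Nov hNov hsmall (hB hN D) hsupp hle Gl (fun c _ => h2133 c)
    (fun c c' => kFam (onFun (dE (P := PV d ℓ m K hd hL) cf ∘ₗ (LinearMap.id - RE (domT hN D hk) cf) ∘ₗ dsE cf))
      (fun c => mulOp (hB hN D c)) (fun c => mulOp (zB hN D hMh1 hP4 c)) Ml Pl c c' * Gl c')
    (fun c _ c' _ => h2134 c c') (fun c _ c' _ => hKout c c') (G0 := gZero Finset.univ (fun c => mulOp (hB hN D c)) Gl)
    (R := rOp Finset.univ (onFun (dE (P := PV d ℓ m K hd hL) cf ∘ₗ (LinearMap.id - RE (domT hN D hk) cf) ∘ₗ dsE cf))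
      (fun c => mulOp (hB hN D c)) (fun c => mulOp (zB hN D hMh1 hP4 c)) Gl Ml Pl) rfl rfl hinv h291
  exact hmain

open Classical in
/-- **THE TWO-FAMILY SKELETON WITH (hKout) DISCHARGED** from the member-side output localisation `hMout : OutLoc (M_□·h_□) □̃` (`outLoc_kFam_big`).
[cite: Balaban1984PropagatorsII, Prop. 2.6 (2.136) p.247, (2.91)–(2.93) p.239, (2.133)–(2.135) p.247] -/
theorem prop26_2136_kLevel_skeleton₂' (hN : ∀ μ, N0 ℓ Mh k P' μ = (PV d ℓ m K hd hL).sitesPerDir 0) (D : TDomains d ℓ Mh k P' R) (hk : k ≤ m + K)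
    (hMh : 2 ≤ Mh) (hR : 2 * (ℓ + 1) ≤ R) (hP5 : ∀ μ, 5 ≤ P' μ)
    {δ A : ℝ} (hδ : 0 < δ) (hA : 0 ≤ A)
    (α : ℝ) (hα0 : 0 ≤ α) (hα1 : α ≤ 1) (N₀ : ℕ) (hN₀ : 0 < N₀) (hRM : N₀ + 1 ≤ R * ((ℓ + 1) * Mh))
    (hθ : Real.exp (-(α * (δ / (d + 1)))) * ((ℓ : ℝ) + 1) ^ ((2 * (d + 1 : ℕ) : ℝ) / N₀) < 1)
    {cf : ℝ} (hcf : cf ≠ 0) {w : BondIdx (domT hN D hk) → ℝ} (hw : ∀ i, 0 < w i)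
    (Nov : ℕ) (hNov : ∀ a : (geomT D).Site, (Finset.univ.filter fun c : ↥(cubes D.toDomains) =>
      a ∈ SbigT D (le_trans one_le_two hMh) (fun μ => le_trans (by norm_num) (hP5 μ)) c).card ≤ Nov)
    (Gl Ml Pl : ↥(cubes D.toDomains) → Module.End ℝ (PBond (PV d ℓ m K hd hL) 0 → ℝ))
    (h2133 : ∀ c, LocalMajorant (g := geomT D) (blkV1 hN D) (Gl c)
      (ST D (le_trans one_le_two hMh) (fun μ => le_trans (by norm_num) (hP5 μ)) c)
      (fun a b => A * pref cf a * Real.exp (-((2 * (δ / (d + 1))) / 2 * (geomT D).dist a b))))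
    (hagree : ∀ c, onFun (dcsE (P := PV d ℓ m K hd hL) cf ∘ₗ dcE cf + dE cf ∘ₗ dsE cf +
        QsE (domT hN D hk) ∘ₗ aE (domT hN D hk) w ∘ₗ QE (domT hN D hk)) * mulOp (hB hN D c) = Ml c * mulOp (hB hN D c))
    (hinvl : ∀ c, (Ml c - Pl c) * Gl c * mulOp (hB hN D c) = mulOp (hB hN D c))
    (hMout : ∀ c, OutLoc (g := geomT D) (blkV1 hN D) (Ml c * mulOp (hB hN D c))
      (SbigT D (le_trans one_le_two hMh) (fun μ => le_trans (by norm_num) (hP5 μ)) c))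
    (θ₀ : ℝ) (hθ₀ : 0 ≤ θ₀)
    (h2134 : ∀ c c', HasMajorant (g := geomT D) (blkV1 hN D)
      ((kFam (onFun (dE (P := PV d ℓ m K hd hL) cf ∘ₗ (LinearMap.id - RE (domT hN D hk) cf) ∘ₗ dsE cf))
          (fun c => mulOp (hB hN D c)) (fun c => mulOp (zB hN D (le_trans one_le_two hMh) (fun μ => le_trans (by norm_num) (hP5 μ)) c))
          Ml Pl c c' * Gl c') * mulOp (hB hN D c'))
      (fun a b => θ₀ * Real.exp (-((2 * (δ / (d + 1))) / 2 * (geomT D).dist a b))))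
    (hsmall : (Nov : ℝ) ^ 2 * θ₀ * K261 N₀ (d + 1) ((ℓ : ℝ) + 1) 1 (α * (δ / (d + 1))) < 1) :
    HasMajorant (g := geomT D) (blkV1 hN D) (onFun (GE (domT hN D hk) hcf hw))
      (fun a b => (Nov * A) * K261 N₀ (d + 1) ((ℓ : ℝ) + 1) 1 (α * (δ / (d + 1))) *
        (1 - (Nov : ℝ) ^ 2 * θ₀ * K261 N₀ (d + 1) ((ℓ : ℝ) + 1) 1 (α * (δ / (d + 1))))⁻¹ * pref cf a *
        Real.exp (-(delta3 α (2 * (δ / (d + 1))) * (geomT D).dist a b))) :=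
  prop26_2136_kLevel_skeleton₂ hN D hk hMh hR hP5 hδ hA α hα0 hα1 N₀ hN₀ hRM hθ hcf hw Nov hNov Gl Ml Pl h2133 hagree hinvl θ₀ hθ₀ h2134
    (outLoc_kFam_big hN D hMh hR (le_trans one_le_two hMh) (fun μ => le_trans (by norm_num) (hP5 μ)) _ Gl Ml Pl hMout) hsmall

end Skeleton

end

end Literature.MathematicalPhysics.QuantumFieldTheory.Balaban1983to89.B6Prop26KLevelSkeletonV2
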